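import Mathlib.Geometry.Manifold.Instances.Real
import Mathlib.Geometry.Manifold.IsManifold.InteriorBoundary
import Mathlib.Geometry.Manifold.VectorField.LieBracket
import Mathlib.Geometry.Manifold.Notation
import Literature.Geometry.Kaehler.ManifoldForms
import HarnessLib

/-!
# Stein domains and Liouville domains (compact 4-manifolds with boundary)

Trunk Literature/Geometry/Symplectic; definition request `defn-IsSteinDomain` (route
SmoothPoincare4/SymplecticCap, cruxes 2–3; facts Eliashberg 1990 / McDuff 1990 on fillings of
`S³`, Akbulut–Matveyev 1998).

A compact smooth 4-manifold `W` with boundary — here: a compact `C^∞` manifold modelled on the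
half-space `𝓡∂ 4` (Mathlib `EuclideanHalfSpace 4`, boundary `{x₀ = 0}`) — is a **Stein domain**
if it carries
* an integrable almost complex structure `J` (a smooth field of endomorphisms of the tangent
  spaces with `J² = -1` and vanishing Nijenhuis tensor
  `N_J(X, Y) = [JX, JY] - J[JX, Y] - J[X, JY] - [X, Y]`, Newlander–Nirenberg), and
* a smooth `J`-convex (strictly plurisubharmonic) function `φ : W → ℝ`, i.e.
  `-d(dφ ∘ J)(v, Jv) > 0` for `v ≠ 0`, of which the boundary is the regular maximal level set
  `∂W = φ⁻¹(max φ)`, `dφ ≠ 0` on `∂W`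
(Eliashberg 1990, §1; Gompf 1998, §1; Cieliebak–Eliashberg 2012, Def. 1.1 ff.: equivalently, a
sublevel set `{φ ≤ c}` of an exhausting `J`-convex function on a Stein surface, `c` regular).

The symplectic shadow used by the route's cruxes is also provided: a **Liouville domain**
`(W, λ)` — `λ` a smooth 1-form with `dλ` symplectic whose Liouville field `Z` (`ι_Z dλ = λ`)
points transversally OUT of `W` along `∂W` (Cieliebak–Eliashberg 2012, §11.1). For a Stein domain,
`λ = -dφ ∘ J` is such a Liouville form ("from Stein to Weinstein"); this bridge is a theorem in
print and is only recorded in prose here.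

## Contents

* `SteinStructure W` (data `J`, `φ` + axioms), `IsSteinDomain W : Prop := Nonempty (SteinStructure W)`;
* `IsLiouvilleDomain W lam : Prop`;
* helpers: `IsSmoothVectorField`, `nijenhuis`, `oneFormOfCLM`, `dComplex J φ = dφ ∘ J`.

## Design choices

* Real dimension fixed to `4` and model `𝓡∂ 4` (what the route needs; everything would generalise
  to `𝓡∂ (2n)` verbatim). Tangent spaces are the model space `E = EuclideanSpace ℝ (Fin 4)`
  (Mathlib's `TangentSpace I x` is definitionally `E`), so `J x : E →L[ℝ] E`.
* Smoothness of `J` is expressed by "`J` maps smooth vector fields to smooth vector fields"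
  (equivalent to smoothness as a section of `End(TW)`); smooth vector fields via Mathlib's
  `T%`/`ContMDiff I I.tangent`.
* Integrability via Mathlib's manifold Lie bracket `VectorField.mlieBracket` on all pairs of
  smooth vector fields (Newlander–Nirenberg form; in real dimension 4 it is a genuine condition).
* Forms use the tree's `Literature.Geometry.Kaehler.MForm`/`Literature.Geometry.Kaehler.mextDeriv`/`Literature.Geometry.Kaehler.IsSmoothForm` (`ManifoldForms.lean`);
  1-forms from linear functionals via Mathlib's `ContinuousAlternatingMap.ofSubsingleton`.
* "Outward" at a boundary point `x`: in the preferred chart at `x` (which identifies `T_xW` with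
  `E` and `W` near `x` with `{y₀ ≥ 0}`), a vector `v` points out iff `v 0 < 0`.
* Mathlib has no symplectic/contact/Stein vocabulary (searched `symplectic`, `Liouville`,
  `plurisubharmonic`, `Stein`); complex manifolds in the tree (`Kaehler.lean`) are boundaryless
  holomorphic atlases, unusable for domains with boundary — hence the almost-complex route.
-/

noncomputable section

open scoped Manifold ContDiff Topology
open Set VectorField

namespace Literature.Geometry.Symplectic

/-- The model vector space `ℝ⁴` of the tangent spaces. [folklore] -/
local notation "E4" => EuclideanSpace ℝ (Fin 4)

variable (W : Type*) [TopologicalSpace W] [ChartedSpace (EuclideanHalfSpace 4) W]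
  [IsManifold (𝓡∂ 4) ∞ W]

/-- A vector field on `W` (a section `x ↦ V x ∈ T_xW = ℝ⁴`) is smooth if it is `C^∞` as a map
into the tangent bundle. [Warner 1983, Def. 1.42] [folklore] -/
def IsSmoothVectorField (V : (x : W) → TangentSpace (𝓡∂ 4) x) : Prop :=
  ContMDiff (𝓡∂ 4) (𝓡∂ 4).tangent ∞ (T% V)

/-- The Nijenhuis tensor of a field of endomorphisms `J` evaluated on vector fields `X, Y`:
`N_J(X, Y) = [JX, JY] - J[JX, Y] - J[X, JY] - [X, Y]` (Mathlib's manifold Lie bracket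
`VectorField.mlieBracket`). [Cieliebak–Eliashberg 2012, §1 (integrable `J`); Newlander–Nirenberg
1957] [folklore] -/
def nijenhuis (J : (x : W) → (E4 →L[ℝ] E4)) (X Y : (x : W) → TangentSpace (𝓡∂ 4) x) (x : W) :
    TangentSpace (𝓡∂ 4) x :=
  let a : E4 := mlieBracket (𝓡∂ 4) (fun y => J y (X y)) (fun y => J y (Y y)) x
  let b : E4 := mlieBracket (𝓡∂ 4) (fun y => J y (X y)) Y x
  let c : E4 := mlieBracket (𝓡∂ 4) X (fun y => J y (Y y)) x
  let e : E4 := mlieBracket (𝓡∂ 4) X Y x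
  a - J x b - J x c - e

variable {W}

/-- A 1-form from a field of continuous linear functionals (Mathlib
`ContinuousAlternatingMap.ofSubsingleton`). [Warner 1983, §2.15] [folklore] -/
def oneFormOfCLM (θ : (x : W) → (E4 →L[ℝ] ℝ)) : Kaehler.MForm (𝓡∂ 4) W ℝ 1 :=
  fun x => ContinuousAlternatingMap.ofSubsingleton ℝ E4 ℝ (0 : Fin 1) (θ x)

/-- The 1-form `d^ℂ φ = dφ ∘ J` of a function `φ` with respect to the almost complex structure `J`.
[Cieliebak–Eliashberg 2012, §1 (`d^ℂ φ`, `-dd^ℂ φ`)] [folklore] -/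
def dComplex (J : (x : W) → (E4 →L[ℝ] E4)) (φ : W → ℝ) : Kaehler.MForm (𝓡∂ 4) W ℝ 1 :=
  oneFormOfCLM fun x => (mfderiv (𝓡∂ 4) 𝓘(ℝ, ℝ) φ x).comp (J x)

variable (W)

/-- **A Stein structure on the compact 4-manifold with boundary `W`**: an integrable almost
complex structure `J` and a smooth `J`-convex function `φ` presenting `∂W` as its regular maximal
level set. Fields: `J² = -1`; `J` preserves smoothness of vector fields; the Nijenhuis tensor
vanishes on smooth vector fields (integrability); `φ` smooth; `-d(dφ ∘ J)(v, Jv) > 0` for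
`v ≠ 0` (`J`-convexity); `∂W = {φ = max φ}` and `dφ ≠ 0` there. [Eliashberg 1990, §1;
Gompf 1998, §1; Cieliebak–Eliashberg 2012, Def. 1.1 ff. (Stein domain = regular sublevel set of
an exhausting `J`-convex function)] [cite: Gompf1998, §1] -/
structure SteinStructure [CompactSpace W] where
  /-- the almost complex structure, `J x : T_xW → T_xW` -/
  J : (x : W) → (E4 →L[ℝ] E4)
  /-- the `J`-convex defining function -/
  φ : W → ℝ
  /-- `J² = -1` -/
  J_sq : ∀ x v, J x (J x v) = -v
  /-- `J` is smooth: it maps smooth vector fields to smooth vector fields -/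
  J_smooth : ∀ X : (x : W) → TangentSpace (𝓡∂ 4) x,
    IsSmoothVectorField W X → IsSmoothVectorField W fun x => J x (X x)
  /-- integrability (Newlander–Nirenberg): the Nijenhuis tensor vanishes -/
  integrable : ∀ X Y : (x : W) → TangentSpace (𝓡∂ 4) x,
    IsSmoothVectorField W X → IsSmoothVectorField W Y → ∀ x, nijenhuis W J X Y x = 0
  /-- `φ` is smooth -/
  φ_smooth : ContMDiff (𝓡∂ 4) 𝓘(ℝ, ℝ) ∞ φ
  /-- `J`-convexity: `-dd^ℂφ (v, Jv) > 0` for `v ≠ 0` -/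
  convex : ∀ x (v : E4), v ≠ 0 → 0 < -(Kaehler.mextDeriv (dComplex J φ) x ![v, J x v])
  /-- the boundary is the maximal level set of `φ` … -/
  boundary_eq : ∀ x, (𝓡∂ 4).IsBoundaryPoint x ↔ φ x = sSup (Set.range φ)
  /-- … and a regular one -/
  regular : ∀ x, (𝓡∂ 4).IsBoundaryPoint x → mfderiv (𝓡∂ 4) 𝓘(ℝ, ℝ) φ x ≠ 0

/-- **`IsSteinDomain W`**: the compact smooth 4-manifold with boundary `W` admits a Stein
structure (`SteinStructure W`). [Eliashberg 1990, §1; Gompf 1998, §1; Cieliebak–Eliashberg 2012,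
Def. 1.1 ff.] [cite: Gompf1998, §1] -/
def IsSteinDomain [CompactSpace W] : Prop :=
  Nonempty (SteinStructure W)

/-- **Liouville domain** `(W, λ)`: `W` compact with boundary, `λ` a smooth 1-form such that
`dλ` is non-degenerate (symplectic) at every point and the Liouville vector field `Z`,
`ι_Z dλ = λ`, points transversally outward along `∂W` (in the boundary chart: negative
`x₀`-component). The symplectic substitute for `IsSteinDomain` accepted by the route (every Stein
domain is a Liouville — indeed Weinstein — domain with `λ = -dφ ∘ J`).
[Cieliebak–Eliashberg 2012, §11.1 (Liouville domains); Eliashberg 1990, §1] [cite: CieliebakEliashberg2012, §11.1] -/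
structure IsLiouvilleDomain [CompactSpace W] (lam : Kaehler.MForm (𝓡∂ 4) W ℝ 1) : Prop where
  /-- `λ` is smooth -/
  smooth : Kaehler.IsSmoothForm lam
  /-- `dλ` is non-degenerate at every point -/
  nondegenerate : ∀ x (v : E4), (∀ w : E4, Kaehler.mextDeriv lam x ![v, w] = 0) → v = 0
  /-- the Liouville field (`ι_Z dλ = λ`) points out of `W` transversally along `∂W` -/
  outward : ∀ x, (𝓡∂ 4).IsBoundaryPoint x →
    ∀ v : E4, (∀ w : E4, Kaehler.mextDeriv lam x ![v, w] = lam x ![w]) → v 0 < 0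

/-! ### API -/

variable {W}

omit [IsManifold (𝓡∂ 4) ∞ W] in
/-- Pointwise unfolding of `d^ℂ φ`: `(dφ ∘ J)(v)`. [Cieliebak–Eliashberg 2012, §1] [folklore] -/
@[simp] theorem dComplex_apply (J : (x : W) → (E4 →L[ℝ] E4)) (φ : W → ℝ) (x : W) (v : Fin 1 → E4) :
    dComplex J φ x v = mfderiv (𝓡∂ 4) 𝓘(ℝ, ℝ) φ x (J x (v 0)) :=
  rfl

/-- `J` has no real eigenvector: `J v ≠ v` for `v ≠ 0` (from `J² = -1`, characteristic `0`).
[folklore] -/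
theorem SteinStructure.J_ne_self [CompactSpace W] (S : SteinStructure W)
    (x : W) {v : E4} (hv : v ≠ 0) : S.J x v ≠ v := by
  intro h
  have h2 := S.J_sq x v
  rw [h, h] at h2
  have : (2 : ℝ) • v = 0 := by rw [two_smul]; nth_rewrite 2 [h2]; exact add_neg_cancel v
  exact hv (by simpa using this)

/-- A Stein structure's `J` is injective at every point. [folklore] -/
theorem SteinStructure.J_injective [CompactSpace W] (S : SteinStructure W)
    (x : W) : Function.Injective (S.J x) := fun v w h => by
  have := congrArg (S.J x) h
  rwa [S.J_sq, S.J_sq, neg_inj] at this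

end Literature.Geometry.Symplectic
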